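import Mathlib.Algebra.BigOperators.Fin
import Mathlib.Data.Fintype.BigOperators
import Literature.Computability.Complexity.AOWBias
import Literature.Computability.Complexity.AOWTraceCertificate
import HarnessLib

/-!
# Level matrices: the `S`-bias as a bilinear form and its trace certificate
(Allen–O'Donnell–Witmer 2015, §4.2 and App. A.1)

Trunk T-CPLX-CORE (Literature/Computability/Complexity). Support file for the discharge of the
named fact `allen_odonnell_witmer_kSAT` (`AOWRefutation.lean`), deterministic part II.

Fix a set of positions `S = f([a+b]) ⊆ [k]` enumerated by an injective `f : Fin (a+b) → Fin k`,
split into its first `a` and last `b` positions (`e₁ = f ∘ castAdd b`, `e₂ = f ∘ natAdd a`). The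
**level matrix** `B = levelMatrix L S e₁ e₂`, indexed by `[n]^a × [n]^b`, has the INTEGER entries

  `B(u, v) = ∑_{(T,c) ∈ L : T ∘ e₁ = u, T ∘ e₂ = v} ∏_{i ∈ S} (±1)^{c_i}`

(signed counts of constraints by their `S`-sub-scope; Allen–O'Donnell–Witmer, proof of Lemma 4.3,
eq. (4), and App. A.1 eq. (even-k): `∑_T w(T) x^T = ∑_{T₁,T₂} w(T₁,T₂) y_{T₁} y_{T₂}`). Then

  `bias_S(x) = X_a(x)ᵀ · B · X_b(x)`,  `X_a(x)(u) = ∏_j (±1)^{x(u_j)}`  (`bias_image_eq_bilinear`),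

and the trace certificate of `AOWTraceCertificate.lean` gives the computable test
`(2^k)^{2q} · (n^a)^q (n^b)^q · tr((BᵀB)^q) < m^{2q} ⟹ 2^k |bias_S(x)| < m for all x`
(`two_pow_mul_abs_bias_lt_of_levelCheck`), `q = 2^j`.

## References

* S. R. Allen, R. O'Donnell, D. Witmer, *How to refute a random CSP*, FOCS 2015,
  arXiv:1505.04383: proof of Lemma 4.3 (eq. (4)), App. A.1 (even arity: the quadratic form
  `yᵀ B y`, "compute ‖B‖").
-/

namespace Literature.Computability.Complexity

open Finset Matrix

variable {k n a b : ℕ}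

/-! ### Sign tensors -/

/-- The sign tensor of an assignment: `X(u) = ∏_j (±1)^{x (u j)}` for `u ∈ [n]^a` (the vector
`x^{⊗a}` of Allen–O'Donnell–Witmer restricted to `±1` inputs). [Allen–O'Donnell–Witmer 2015,
App. A (`y_U = x^U`)] [cite: arXiv150504383, App. A] -/
def tensorSign (x : Fin n → Bool) (u : Fin a → Fin n) : ℤ :=
  ∏ j, pmSign (x (u j))

/-- Entries of the sign tensor square to `1`. [folklore] -/
@[simp] theorem tensorSign_sq (x : Fin n → Bool) (u : Fin a → Fin n) : tensorSign x u ^ 2 = 1 :=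
  prod_pmSign_sq _ _

/-- `Xᵀ X = n^a`. [Allen–O'Donnell–Witmer 2015, App. A.1 (`‖y‖² ≤ n^{k/2}`)] [folklore] -/
theorem tensorSign_dotProduct_self (x : Fin n → Bool) :
    (tensorSign (a := a) x) ⬝ᵥ (tensorSign x) = (n : ℤ) ^ a := by
  have h : ∀ u : Fin a → Fin n, tensorSign x u * tensorSign x u = 1 := fun u => by
    rw [← sq, tensorSign_sq]
  simp only [dotProduct, h, Finset.sum_const, Finset.card_univ, nsmul_eq_mul, mul_one]
  rw [Fintype.card_fun, Fintype.card_fin, Fintype.card_fin]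
  push_cast
  rfl

namespace AOWConstraint

/-- The sign of a constraint on the position set `S`: `∏_{i ∈ S} (±1)^{c_i}`.
[Allen–O'Donnell–Witmer 2015, proof of Lemma 4.3 (`c^S`)] [cite: arXiv150504383, Lemma 4.3] -/
def signAt (C : AOWConstraint k n) (S : Finset (Fin k)) : ℤ :=
  ∏ i ∈ S, pmSign (C.2 i)

/-- `|signAt C S| = 1`. [folklore] -/
@[simp] theorem abs_signAt (C : AOWConstraint k n) (S : Finset (Fin k)) : |C.signAt S| = 1 := by
  rw [signAt, Finset.abs_prod]
  exact Finset.prod_eq_one fun i _ => abs_pmSign _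

/-- `signAt C S ^ 2 = 1`. [folklore] -/
@[simp] theorem signAt_sq (C : AOWConstraint k n) (S : Finset (Fin k)) : C.signAt S ^ 2 = 1 :=
  prod_pmSign_sq _ _

/-- Factorisation of the `S`-term of the bias along a split `S = f(castAdd) ⊔ f(natAdd)`:
`∏_{i∈S} z_i(C,x) = signAt C S · X(T ∘ e₁) · X(T ∘ e₂)`. [Allen–O'Donnell–Witmer 2015, proof of
Lemma 4.3 (eq. (4)) and App. A.1] [folklore] -/
theorem prod_litSign_image (C : AOWConstraint k n) (x : Fin n → Bool) (f : Fin (a + b) → Fin k)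
    (hf : Function.Injective f) :
    ∏ i ∈ univ.image f, C.litSign x i =
      C.signAt (univ.image f) * tensorSign x (C.1 ∘ f ∘ Fin.castAdd b) *
        tensorSign x (C.1 ∘ f ∘ Fin.natAdd a) := by
  simp only [litSign, Finset.prod_mul_distrib, signAt]
  rw [mul_comm, mul_assoc]
  congr 1
  rw [Finset.prod_image fun i _ j _ h => hf h, Fin.prod_univ_add]
  rfl

end AOWConstraint

/-! ### The level matrix -/

/-- The single-constraint contribution to the level matrix: `signAt C S` at entry
`(T ∘ e₁, T ∘ e₂)`, zero elsewhere. [folklore] -/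
def levelEntry (C : AOWConstraint k n) (S : Finset (Fin k)) (e₁ : Fin a → Fin k)
    (e₂ : Fin b → Fin k) (u : Fin a → Fin n) (v : Fin b → Fin n) : ℤ :=
  if u = C.1 ∘ e₁ ∧ v = C.1 ∘ e₂ then C.signAt S else 0

/-- **The level matrix** of the constraint multiset `L` for the position set `S` split as
`(e₁, e₂)`: `B(u,v) = ∑_{C ∈ L : T ∘ e₁ = u, T ∘ e₂ = v} signAt C S`, an integer
`[n]^a × [n]^b` matrix. [Allen–O'Donnell–Witmer 2015, App. A.1 (`B_{U₁,U₂} = w(U₁,U₂)`) and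
proof of Lemma 4.3] [cite: arXiv150504383, App. A] -/
def levelMatrix (L : List (AOWConstraint k n)) (S : Finset (Fin k)) (e₁ : Fin a → Fin k)
    (e₂ : Fin b → Fin k) : Matrix (Fin a → Fin n) (Fin b → Fin n) ℤ :=
  Matrix.of fun u v => (L.map fun C => levelEntry C S e₁ e₂ u v).sum

/-- `levelMatrix [] = 0`. [folklore] -/
@[simp] theorem levelMatrix_nil (S : Finset (Fin k)) (e₁ : Fin a → Fin k) (e₂ : Fin b → Fin k) :
    levelMatrix ([] : List (AOWConstraint k n)) S e₁ e₂ = (0 : Matrix (Fin a → Fin n) _ ℤ) := by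
  ext u v
  simp [levelMatrix]

/-- `levelMatrix (C :: L) = (single entry of C) + levelMatrix L`. [folklore] -/
theorem levelMatrix_cons (C : AOWConstraint k n) (L : List (AOWConstraint k n)) (S : Finset (Fin k))
    (e₁ : Fin a → Fin k) (e₂ : Fin b → Fin k) :
    levelMatrix (C :: L) S e₁ e₂ =
      Matrix.of (levelEntry (n := n) C S e₁ e₂) + levelMatrix L S e₁ e₂ := by
  ext u v
  simp [levelMatrix]

/-- The bilinear form of a single-entry matrix. [folklore] -/
theorem dotProduct_of_levelEntry_mulVec (C : AOWConstraint k n) (S : Finset (Fin k))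
    (e₁ : Fin a → Fin k) (e₂ : Fin b → Fin k) (y : (Fin a → Fin n) → ℤ)
    (z : (Fin b → Fin n) → ℤ) :
    y ⬝ᵥ (Matrix.of (levelEntry (n := n) C S e₁ e₂) *ᵥ z) =
      C.signAt S * y (C.1 ∘ e₁) * z (C.1 ∘ e₂) := by
  simp only [dotProduct, Matrix.mulVec, Matrix.of_apply, levelEntry]
  have h : ∀ u : Fin a → Fin n,
      y u * ∑ v, (if u = C.1 ∘ e₁ ∧ v = C.1 ∘ e₂ then C.signAt S else 0) * z v =
        if u = C.1 ∘ e₁ then y u * (C.signAt S * z (C.1 ∘ e₂)) else 0 := by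
    intro u
    split_ifs with hu
    · subst hu
      simp
    · simp [hu]
  rw [Finset.sum_congr rfl fun u _ => h u, Finset.sum_ite_eq']
  simp only [Finset.mem_univ, if_true]
  ring

/-- **The bias is a bilinear form in the sign tensors**: for `S = f([a+b])` with `f` injective,
`bias_S(x) = X_aᵀ · levelMatrix L S (f ∘ castAdd b) (f ∘ natAdd a) · X_b`.
[Allen–O'Donnell–Witmer 2015, proof of Lemma 4.3 (eq. (4)); App. A.1 (eq. (even-k))] [cite: arXiv150504383, App. A] -/
theorem bias_image_eq_bilinear (L : List (AOWConstraint k n)) (x : Fin n → Bool)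
    (f : Fin (a + b) → Fin k) (hf : Function.Injective f) :
    bias L (univ.image f) x =
      tensorSign x ⬝ᵥ
        (levelMatrix L (univ.image f) (f ∘ Fin.castAdd b) (f ∘ Fin.natAdd a) *ᵥ tensorSign x) := by
  induction L with
  | nil => simp
  | cons C L ih =>
    rw [bias_cons, levelMatrix_cons, Matrix.add_mulVec, dotProduct_add,
      dotProduct_of_levelEntry_mulVec, ← ih, C.prod_litSign_image x f hf]

/-- **The computable level test implies the bias bound.** If
`(2^k)^{2q} · ((n^a)^q (n^b)^q · tr((BᵀB)^q)) < m^{2q}` for the level matrix `B` of the split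
`f`, `q = 2^j`, `m = |L|`, then `2^k · |bias_S(x)| < m` for EVERY assignment `x`.
[Allen–O'Donnell–Witmer 2015, App. A.1 with the Claim of App. A.4 (`‖B‖^{2r} ≤ tr((BᵀB)^r)`)] [cite: arXiv150504383, App. A] -/
theorem two_pow_mul_abs_bias_lt_of_levelCheck (L : List (AOWConstraint k n))
    (f : Fin (a + b) → Fin k) (hf : Function.Injective f) (j : ℕ)
    (h : ((2 : ℤ) ^ k) ^ (2 * 2 ^ j) *
        (((n : ℤ) ^ a) ^ 2 ^ j * ((n : ℤ) ^ b) ^ 2 ^ j *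
          (((levelMatrix L (univ.image f) (f ∘ Fin.castAdd b) (f ∘ Fin.natAdd a))ᵀ *
              levelMatrix L (univ.image f) (f ∘ Fin.castAdd b) (f ∘ Fin.natAdd a)) ^
            2 ^ j).trace) <
      (L.length : ℤ) ^ (2 * 2 ^ j))
    (x : Fin n → Bool) : (2 : ℤ) ^ k * |bias L (univ.image f) x| < L.length := by
  rw [bias_image_eq_bilinear L x f hf]
  refine mul_abs_bilinear_lt_of_trace_lt _ _ _ j (by positivity) (by positivity) ?_
  rwa [tensorSign_dotProduct_self, tensorSign_dotProduct_self]

end Literature.Computability.Complexity
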